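import Summits.QuantumFields.BalabanUV.T4Continuum.Support.ShellMeasureAxialReach
import Summits.QuantumFields.BalabanUV.T4Continuum.Support.ShellMeasureWindowRestrict
import Mathlib.Analysis.SpecialFunctions.Trigonometric.Bounds

/-!
# `T4Continuum.ShellMeasureWindowReachLive` — row S87 f3 (owner audit γ3, crew half): (LR)_j REACH AT THE BLOCK — the
# live-level END's reach reading `hreach` ∕ window-support binder `hFsupp′` PRODUCED from S1's axial reach on the block
# `□^{∼4}` and ONE displayed reading «sub-threshold tested variable ⟹ the block's unit plaquettes are `a`-small»
(cell `pub-balaban`, sub-cell `t4`, spine estimate NE7c (node U5b); NE7c ROUND-2 crew, unit `b2b-balaban-t4-ne7c-formalise-leaf-08`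
gen 14; owner table `t4/b2b-balaban-t4-ne7c-p1/LEAVES-NE7c-P1.md` row S87 f3 (my Q ∕ OFFER γ3-A journal l.18145, owner g32 GO
R-ne7cp1-g32-3 (b) l.18202, CLAIM + SHAPE l.18275); ADDITIVE — imports S1 `ShellMeasureAxialReach` (owner g26, p207245), the
owner's S87 `ShellMeasureWindowRestrict` (p228621) and Mathlib's Jordan inequality ONLY; [folklore]; 0 `def`, 0 `def … : Prop`,
0 sorry, 0 citation tags)

HONEST FRAMING.  Finite four-torus programme, rung (B)+1 only — NOT infinite volume, NOT a mass gap, NOT the Clay problem,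
NOT summit progress; (B), `BetaPertHyp`, (B^μ) not consumed.  NE7c (`T4IndicatorShell.ShellWeightBound`) is NOT PRINTED in
[Balaban 1983–89] and NOT PROVED; «NE7c ⇐ the named binders» (trigger c3).  Nothing printed is asserted.  This file is
configuration-level GEOMETRY (S1's reach lemma fired on a box) plus one `by_cases`; its ONE located input — the reading
«`u(W) < θ_j` ⟹ the unit plaquettes of `W` on `□^{∼4}` are `a`-small» (owner NOTE N-ne7cp1-g32-2: B14 (2.16)–(2.17), the
tested variable is the sup of the localized minimiser's FINE plaquette deviations, whose block average is the configuration
on `□`, composed with average regularity of [Balaban1985Averaging] Props 1∕2 TYPE) — is a DISPLAYED HYPOTHESIS (`hsmall`),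
asserted by nobody (c2: a binder, not a `def … : Prop`).  HONEST DEPENDENCY (cell): continuum YM on T⁴ ⇐ BetaPertH ∧ nine
spine estimates (0/9 proved); BetaPertH ⇐ (D1) ∧ (D4) ∧ CAP+tail; G-an2-4 gates asym, D1 and NE2/3/4.

THE POINT (γ3, WALL-NE7c-P1 v2.3 §2b rows `S`∕`hSr`∕`hFsupp`∕`W`).  The live-level END hosts
(`ShellMeasureLandauEndRayStokes.…_stokes(_live)`, `ShellMeasureLandauEndFinal.…_final`, S80 `…_assembled`) display the WINDOW
binder `hFsupp : ∀ V y, F (fixTo T U₀ (V[Λ := y])) ≠ 0 → ∀ b ∈ Λ, dist1 ((c V b)⁻¹·y_b) ≤ 2 sin(S∕2)`.  The owner's S87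
(`ShellMeasureWindowRestrict`) shows that it suffices to inhabit it for the RESTRICTED density `F′ := 𝟙{u < θ}·F` (§1–§2 there)
and that `F′` meets it as soon as ONE reach reading holds (§3 `support_of_indicator_mul`, hypothesis `hreach`).  THIS FILE
produces that reading — in the sectionwise `(V, y)`-form the END consumes, at S1's level-0 instantiation `T := combBonds lo hi`
(the axial comb of the box `□^{∼4} = [lo, hi]`, `hi ≤ lo + n`), `U₀ := 1`, `c := fun _ => 1` — from S1
`ShellMeasureAxialReach.dist1_fixTo_comb_le` («comb-trivial + box plaquettes `a`-small ⟹ every box bond within `(d−1)·n·a` of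
`1`») and the displayed reading `hsmall`, with the radius condition `(d−1)·n·a ≤ 2 sin(S∕2)` (§2–§3), or its LINEAR form
`(d−1)·n·a ≤ 2S∕π`, `S ≤ π` (§1 Jordan: `2S∕π ≤ 2 sin(S∕2)`; the owner's `S_j = (π∕2)(d−1)n_j·a`; the ENDs' `3S² < π²` gives
`S ≤ π`) (§4).  The tree binder of the hosts is `T4TreeGaugeFixing.noClosedLoop_combBonds hN` under the displayed NON-WRAPPING
condition `hN : ∀ κ, hi κ − lo κ < P.sitesPerDir j` (`n_j < T_j`) — cited BY NAME, not restated.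
* §1 `two_mul_div_pi_le_two_sin_half` (Jordan), `rad_of_linear`.
* §2 **`hreach_of_plaqSmall`** (any `GaugeGroup G`): the END's `hreach`∕`hFsupp` CONSEQUENT
  `∀ V y, u (fixTo (combBonds lo hi) 1 (V[Λ := y])) < θ → ∀ b ∈ Λ, dist1 (((1 : GaugeField) b)⁻¹ · y_b) ≤ 2 sin(S∕2)` from the box
  data (`hn`, `hΛbox`, `hΛcomb`, `0 ≤ a`, `hrad`) + `hsmall` (sectionwise); `hreach_of_plaqSmall_of_forall` (configuration-level
  `hsmall : ∀ W, u W < θ → PlaqSmallOn (boxPlaqs lo hi) a W`); `dist1_section_le` (the bare reach: `≤ (d−1)·n·a`).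
* §3 **`hFsupp_indicator_of_plaqSmall`**: the END's `hFsupp` binder LITERALLY for `F′ := {W | u W < θ}.indicator F` (any
  `F : GaugeField P j G → ℝ≥0∞`), `T := combBonds lo hi`, `U₀ := 1`, `c := fun _ => 1` — the `support_of_indicator_mul` pattern of
  S87 §3, sectionwise; `…_of_forall`.
* §4 `hreach_of_plaqSmall_linear` ∕ `hFsupp_indicator_of_plaqSmall_linear` (radius `2S∕π`, `S ≤ π`), `le_pi_of_three_sq_lt`.
NOT HERE: the reading `hsmall` itself (located, W-c∕[B7] Props 1∕2 TYPE; for the explicit one-step average the regularity is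
KERNEL in the tree, `B7Prop2Explicit`, but its composition with the (2.16) dictionary is node O); the END-side wiring (leaf-03-g6's
S87 f2: `Jco′ := Jco·𝟙{u∘section<θ}`, centre-monotonicity, `slotAntiConcentration_withDensity_of_indicator`); any estimate of
Bałaban's.  NOTHING in the countdown moves; NE7c NOT PROVED; spine PROVED 0∕9.
-/

noncomputable section

open Set

namespace Summit.QuantumFields.BalabanUV.T4Continuum.ShellMeasureWindowReachLive

open scoped ENNReal
open Literature.MathematicalPhysics.QuantumFieldTheory.Balaban1983to89
open T4AxialGaugeSmallField (boxPlaqs boxBonds)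
open T4AxialGaugeFixing (combBonds)
open T4TreeGaugeFixing (fixTo fixTo_apply_of_not_mem)
open T4TiltOscillation (updateFinset_apply_of_mem)
open ShellMeasureAxialReach (dist1_fixTo_comb_le)

/-! ## §1 Jordan: the linear radius `2S∕π` is below the window radius `2 sin(S∕2)` -/

/-- **JORDAN**: `2S∕π ≤ 2·sin(S∕2)` for `0 ≤ S ≤ π` (Mathlib `Real.mul_le_sin` at `S∕2 ∈ [0, π∕2]`). [folklore] -/
theorem two_mul_div_pi_le_two_sin_half {S : ℝ} (hS : 0 ≤ S) (hSπ : S ≤ Real.pi) :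
    2 * S / Real.pi ≤ 2 * Real.sin (S / 2) := by
  have h := Real.mul_le_sin (x := S / 2) (by linarith) (by linarith)
  have e : 2 / Real.pi * (S / 2) = S / Real.pi := by ring
  rw [e] at h
  calc 2 * S / Real.pi = 2 * (S / Real.pi) := by ring
    _ ≤ 2 * Real.sin (S / 2) := by linarith

/-- the LINEAR radius condition `(d−1)·n·a ≤ 2S∕π` with `0 ≤ S ≤ π` implies the WINDOW radius condition
`(d−1)·n·a ≤ 2 sin(S∕2)` (the owner's `S_j = (π∕2)(d−1)n_j·a` meets the former with equality). [folklore] -/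
theorem rad_of_linear {r S : ℝ} (hS : 0 ≤ S) (hSπ : S ≤ Real.pi) (hr : r ≤ 2 * S / Real.pi) :
    r ≤ 2 * Real.sin (S / 2) :=
  hr.trans (two_mul_div_pi_le_two_sin_half hS hSπ)

/-! ## §2 The reach reading `hreach` from S1's axial reach on the box + the displayed sub-threshold reading -/

section Reach

variable {P : Params} {j : ℕ} {G : Type*} [GaugeGroup G] [DecidableEq (PBond P j)]

/-- **THE BARE REACH ON A SECTION**: for chart bonds `Λ` inside the box and disjoint from the comb, if the box plaquettes
of the comb-fixed section `W := (V[Λ := y])[comb := 1]` are `a`-small then every chart coordinate is within `(d−1)·n·a` of `1`: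
`dist1 (y_b) ≤ (d−1)·n·a` (S1 `dist1_fixTo_comb_le` + `W b = y_b` on `Λ`). [folklore] -/
theorem dist1_section_le {lo hi : Fin P.d → ℤ} {n : ℕ} (hn : ∀ κ, hi κ ≤ lo κ + n)
    (Λ : Finset (PBond P j)) (hΛbox : ∀ b ∈ Λ, b ∈ boxBonds lo hi) (hΛcomb : Disjoint Λ (combBonds lo hi))
    {a : ℝ} (ha : 0 ≤ a) (V : GaugeField P j G) (y : ↥Λ → G)
    (hUa : PlaqSmallOn (boxPlaqs lo hi) a (fixTo (combBonds lo hi) 1 (Function.updateFinset V Λ y)))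
    {b : PBond P j} (hb : b ∈ Λ) :
    dist1 (y ⟨b, hb⟩) ≤ ((P.d - 1 : ℕ) : ℝ) * n * a := by
  have h := dist1_fixTo_comb_le (Function.updateFinset V Λ y) subset_rfl hUa ha hn (hΛbox b hb)
  rwa [fixTo_apply_of_not_mem (Finset.disjoint_left.1 hΛcomb hb), updateFinset_apply_of_mem V y hb] at h

/-- **THE END's REACH READING `hreach` (γ3-A), sectionwise.**  Box `[lo, hi]` with `hi ≤ lo + n` (the block `□^{∼4}`,
`n = n_j` unit steps of the level-`j` lattice), chart bonds `Λ ⊆ boxBonds lo hi` DISJOINT from the axial comb, `0 ≤ a`, radius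
`(d−1)·n·a ≤ 2 sin(S∕2)`, a tested variable `u` with threshold `θ`, and THE ONE DISPLAYED READING `hsmall`: at every
comb-fixed section, `u < θ ⟹` the box plaquettes are `a`-small (B14 (2.16)–(2.17) + [B7] Props 1∕2 TYPE — located, NOT
asserted).  CONCLUSION — the consequent of the END hosts' `hFsupp` at `T := combBonds lo hi`, `U₀ := 1`, `c := fun _ => 1`:
`u ((V[Λ := y])[comb := 1]) < θ ⟹ ∀ b ∈ Λ, dist1 (((1 : GaugeField) b)⁻¹ · y_b) ≤ 2 sin(S∕2)`. [folklore] -/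
theorem hreach_of_plaqSmall {lo hi : Fin P.d → ℤ} {n : ℕ} (hn : ∀ κ, hi κ ≤ lo κ + n)
    (Λ : Finset (PBond P j)) (hΛbox : ∀ b ∈ Λ, b ∈ boxBonds lo hi) (hΛcomb : Disjoint Λ (combBonds lo hi))
    {a S : ℝ} (ha : 0 ≤ a) (hrad : ((P.d - 1 : ℕ) : ℝ) * n * a ≤ 2 * Real.sin (S / 2))
    {u : GaugeField P j G → ℝ} {θ : ℝ}
    (hsmall : ∀ (V : GaugeField P j G) (y : ↥Λ → G),
      u (fixTo (combBonds lo hi) 1 (Function.updateFinset V Λ y)) < θ →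
        PlaqSmallOn (boxPlaqs lo hi) a (fixTo (combBonds lo hi) 1 (Function.updateFinset V Λ y))) :
    ∀ (V : GaugeField P j G) (y : ↥Λ → G), u (fixTo (combBonds lo hi) 1 (Function.updateFinset V Λ y)) < θ →
      ∀ b (hb : b ∈ Λ), dist1 (((1 : GaugeField P j G) b)⁻¹ * y ⟨b, hb⟩) ≤ 2 * Real.sin (S / 2) := by
  intro V y hu b hb
  rw [show ((1 : GaugeField P j G) b)⁻¹ * y ⟨b, hb⟩ = y ⟨b, hb⟩ by
    simp [show (1 : GaugeField P j G) b = 1 from rfl]]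
  exact (dist1_section_le hn Λ hΛbox hΛcomb ha V y (hsmall V y hu) hb).trans hrad

/-- … with the reading in CONFIGURATION-LEVEL form `∀ W, u W < θ → PlaqSmallOn (boxPlaqs lo hi) a W` (gauge-invariant
statement; only its comb-fixed sections are used). [folklore] -/
theorem hreach_of_plaqSmall_of_forall {lo hi : Fin P.d → ℤ} {n : ℕ} (hn : ∀ κ, hi κ ≤ lo κ + n)
    (Λ : Finset (PBond P j)) (hΛbox : ∀ b ∈ Λ, b ∈ boxBonds lo hi) (hΛcomb : Disjoint Λ (combBonds lo hi))
    {a S : ℝ} (ha : 0 ≤ a) (hrad : ((P.d - 1 : ℕ) : ℝ) * n * a ≤ 2 * Real.sin (S / 2))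
    {u : GaugeField P j G → ℝ} {θ : ℝ} (hsmall : ∀ W : GaugeField P j G, u W < θ → PlaqSmallOn (boxPlaqs lo hi) a W) :
    ∀ (V : GaugeField P j G) (y : ↥Λ → G), u (fixTo (combBonds lo hi) 1 (Function.updateFinset V Λ y)) < θ →
      ∀ b (hb : b ∈ Λ), dist1 (((1 : GaugeField P j G) b)⁻¹ * y ⟨b, hb⟩) ≤ 2 * Real.sin (S / 2) :=
  hreach_of_plaqSmall hn Λ hΛbox hΛcomb ha hrad fun _ _ hu => hsmall _ hu

end Reach

/-! ## §3 The END's window-support binder `hFsupp` for the restricted density `𝟙{u < θ}·F` -/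

section Support

variable {P : Params} {j : ℕ} {G : Type*} [GaugeGroup G] [DecidableEq (PBond P j)]

/-- **THE END's `hFsupp` FOR `F′ := 𝟙{u < θ}·F` (γ3: S87 §3's `support_of_indicator_mul`, sectionwise).**  Same data as
`hreach_of_plaqSmall`, any density `F`.  CONCLUSION — LITERALLY the END hosts' binder at `T := combBonds lo hi`, `U₀ := 1`,
`c := fun _ => 1`: `(𝟙{u < θ}·F)((V[Λ := y])[comb := 1]) ≠ 0 ⟹ ∀ b ∈ Λ, dist1 (((1 : GaugeField) b)⁻¹ · y_b) ≤ 2 sin(S∕2)`.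
[folklore] -/
theorem hFsupp_indicator_of_plaqSmall {lo hi : Fin P.d → ℤ} {n : ℕ} (hn : ∀ κ, hi κ ≤ lo κ + n)
    (Λ : Finset (PBond P j)) (hΛbox : ∀ b ∈ Λ, b ∈ boxBonds lo hi) (hΛcomb : Disjoint Λ (combBonds lo hi))
    {a S : ℝ} (ha : 0 ≤ a) (hrad : ((P.d - 1 : ℕ) : ℝ) * n * a ≤ 2 * Real.sin (S / 2))
    {u : GaugeField P j G → ℝ} {θ : ℝ}
    (hsmall : ∀ (V : GaugeField P j G) (y : ↥Λ → G),
      u (fixTo (combBonds lo hi) 1 (Function.updateFinset V Λ y)) < θ →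
        PlaqSmallOn (boxPlaqs lo hi) a (fixTo (combBonds lo hi) 1 (Function.updateFinset V Λ y)))
    (F : GaugeField P j G → ℝ≥0∞) :
    ∀ (V : GaugeField P j G) (y : ↥Λ → G),
      ({W | u W < θ}.indicator F) (fixTo (combBonds lo hi) 1 (Function.updateFinset V Λ y)) ≠ 0 →
        ∀ b (hb : b ∈ Λ), dist1 (((1 : GaugeField P j G) b)⁻¹ * y ⟨b, hb⟩) ≤ 2 * Real.sin (S / 2) := by
  intro V y hF
  by_cases hu : u (fixTo (combBonds lo hi) 1 (Function.updateFinset V Λ y)) < θ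
  · exact hreach_of_plaqSmall hn Λ hΛbox hΛcomb ha hrad hsmall V y hu
  · exact absurd (indicator_of_notMem (show fixTo (combBonds lo hi) 1 (Function.updateFinset V Λ y) ∉
      {W | u W < θ} from hu) F) hF

/-- … with the reading in configuration-level form. [folklore] -/
theorem hFsupp_indicator_of_plaqSmall_of_forall {lo hi : Fin P.d → ℤ} {n : ℕ} (hn : ∀ κ, hi κ ≤ lo κ + n)
    (Λ : Finset (PBond P j)) (hΛbox : ∀ b ∈ Λ, b ∈ boxBonds lo hi) (hΛcomb : Disjoint Λ (combBonds lo hi))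
    {a S : ℝ} (ha : 0 ≤ a) (hrad : ((P.d - 1 : ℕ) : ℝ) * n * a ≤ 2 * Real.sin (S / 2))
    {u : GaugeField P j G → ℝ} {θ : ℝ} (hsmall : ∀ W : GaugeField P j G, u W < θ → PlaqSmallOn (boxPlaqs lo hi) a W)
    (F : GaugeField P j G → ℝ≥0∞) :
    ∀ (V : GaugeField P j G) (y : ↥Λ → G),
      ({W | u W < θ}.indicator F) (fixTo (combBonds lo hi) 1 (Function.updateFinset V Λ y)) ≠ 0 →
        ∀ b (hb : b ∈ Λ), dist1 (((1 : GaugeField P j G) b)⁻¹ * y ⟨b, hb⟩) ≤ 2 * Real.sin (S / 2) :=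
  hFsupp_indicator_of_plaqSmall hn Λ hΛbox hΛcomb ha hrad (fun _ _ hu => hsmall _ hu) F

/-- the same binder, seen through S87 §3 `ShellMeasureWindowRestrict.support_of_indicator_mul` with the section-INDEPENDENT
property `P W := ∀ b ∈ Λ, dist1 (W[comb := 1] b) ≤ 2 sin(S∕2)` — for readers who want the owner's lemma BY NAME (here the
reading is asked of `W[comb := 1]` for every `W`; no disjointness needed). [folklore] -/
theorem support_of_indicator_mul_section {lo hi : Fin P.d → ℤ} {n : ℕ} (hn : ∀ κ, hi κ ≤ lo κ + n)
    (Λ : Finset (PBond P j)) (hΛbox : ∀ b ∈ Λ, b ∈ boxBonds lo hi) {a S : ℝ} (ha : 0 ≤ a) (hrad : ((P.d - 1 : ℕ) : ℝ) * n * a ≤ 2 * Real.sin (S / 2))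
    {u : GaugeField P j G → ℝ} {θ : ℝ}
    (hsmall : ∀ W : GaugeField P j G, u W < θ → PlaqSmallOn (boxPlaqs lo hi) a (fixTo (combBonds lo hi) 1 W))
    (F : GaugeField P j G → ℝ≥0∞) :
    ∀ W : GaugeField P j G, ({W | u W < θ}.indicator F) W ≠ 0 →
      ∀ b ∈ Λ, dist1 (fixTo (combBonds lo hi) 1 W b) ≤ 2 * Real.sin (S / 2) :=
  ShellMeasureWindowRestrict.support_of_indicator_mul fun W hu b hb =>
    (dist1_fixTo_comb_le W subset_rfl (hsmall W hu) ha hn (hΛbox b hb)).trans hrad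

end Support

/-! ## §4 The linear radius (the owner's `S_j = (π∕2)(d−1)n_j·a`); the tree binder is `noClosedLoop_combBonds` BY NAME -/

section Linear

variable {P : Params} {j : ℕ} {G : Type*} [GaugeGroup G] [DecidableEq (PBond P j)]

/-- **`hreach` WITH THE LINEAR RADIUS**: `(d−1)·n·a ≤ 2S∕π` and `0 ≤ S ≤ π` (the END hosts' `3S² < π²` gives `S < π`).
[folklore] -/
theorem hreach_of_plaqSmall_linear {lo hi : Fin P.d → ℤ} {n : ℕ} (hn : ∀ κ, hi κ ≤ lo κ + n)
    (Λ : Finset (PBond P j)) (hΛbox : ∀ b ∈ Λ, b ∈ boxBonds lo hi) (hΛcomb : Disjoint Λ (combBonds lo hi))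
    {a S : ℝ} (ha : 0 ≤ a) (hS : 0 ≤ S) (hSπ : S ≤ Real.pi) (hrad : ((P.d - 1 : ℕ) : ℝ) * n * a ≤ 2 * S / Real.pi)
    {u : GaugeField P j G → ℝ} {θ : ℝ}
    (hsmall : ∀ (V : GaugeField P j G) (y : ↥Λ → G),
      u (fixTo (combBonds lo hi) 1 (Function.updateFinset V Λ y)) < θ →
        PlaqSmallOn (boxPlaqs lo hi) a (fixTo (combBonds lo hi) 1 (Function.updateFinset V Λ y))) :
    ∀ (V : GaugeField P j G) (y : ↥Λ → G), u (fixTo (combBonds lo hi) 1 (Function.updateFinset V Λ y)) < θ →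
      ∀ b (hb : b ∈ Λ), dist1 (((1 : GaugeField P j G) b)⁻¹ * y ⟨b, hb⟩) ≤ 2 * Real.sin (S / 2) :=
  hreach_of_plaqSmall hn Λ hΛbox hΛcomb ha (rad_of_linear hS hSπ hrad) hsmall

/-- **`hFsupp′` WITH THE LINEAR RADIUS.** [folklore] -/
theorem hFsupp_indicator_of_plaqSmall_linear {lo hi : Fin P.d → ℤ} {n : ℕ} (hn : ∀ κ, hi κ ≤ lo κ + n)
    (Λ : Finset (PBond P j)) (hΛbox : ∀ b ∈ Λ, b ∈ boxBonds lo hi) (hΛcomb : Disjoint Λ (combBonds lo hi))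
    {a S : ℝ} (ha : 0 ≤ a) (hS : 0 ≤ S) (hSπ : S ≤ Real.pi) (hrad : ((P.d - 1 : ℕ) : ℝ) * n * a ≤ 2 * S / Real.pi)
    {u : GaugeField P j G → ℝ} {θ : ℝ}
    (hsmall : ∀ (V : GaugeField P j G) (y : ↥Λ → G),
      u (fixTo (combBonds lo hi) 1 (Function.updateFinset V Λ y)) < θ →
        PlaqSmallOn (boxPlaqs lo hi) a (fixTo (combBonds lo hi) 1 (Function.updateFinset V Λ y)))
    (F : GaugeField P j G → ℝ≥0∞) :
    ∀ (V : GaugeField P j G) (y : ↥Λ → G),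
      ({W | u W < θ}.indicator F) (fixTo (combBonds lo hi) 1 (Function.updateFinset V Λ y)) ≠ 0 →
        ∀ b (hb : b ∈ Λ), dist1 (((1 : GaugeField P j G) b)⁻¹ * y ⟨b, hb⟩) ≤ 2 * Real.sin (S / 2) :=
  hFsupp_indicator_of_plaqSmall hn Λ hΛbox hΛcomb ha (rad_of_linear hS hSπ hrad) hsmall F

/-- `3S² < π²` and `0 < S` (the END hosts' `hSπ`, `hS`) give `S ≤ π`. [folklore] -/
theorem le_pi_of_three_sq_lt {S : ℝ} (hS : 0 < S) (hSπ : 3 * S ^ 2 < Real.pi ^ 2) : S ≤ Real.pi := by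
  nlinarith [Real.pi_pos, sq_nonneg (S - Real.pi)]

end Linear

end Summit.QuantumFields.BalabanUV.T4Continuum.ShellMeasureWindowReachLive

end
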